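import Summits.Parity.GeneralizedHardyLittlewood.Theorems.FordMaynardSieveConst01651SieveConst01651LinePart02
import HarnessLib

/-!
# Route `FordMaynardSieveConst01651`, target `SieveConst01651` (stmt-Parity-19185): line `sieve_decomposition` re-homed — proofs, part 3 of 12 (file 4 of 13)

File 4 of 13 of the VERBATIM re-homing under `Theorems/` of the registered line skeleton
`Summits/Parity/GeneralizedHardyLittlewood/Cruxes/SieveConst01651/Lines/sieve_decomposition.lean` (v21, sha16
`ada6d0765119a11e`; author seat `linewriter-parity-smallroutes-1`, g0 v1–v20 / g1 v21): Ford–Maynard, Theorem 7.3 (a) at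
`P = (1/2, 0, ν)` with CLOSED support, cut along arXiv:2407.14368 §7.2 / §6.2, composed down to the route target
`Summit.Parity.GeneralizedHardyLittlewood.Theses.FordMaynardSieveConst01651.SieveConst01651`.  Namespace
`Summit.Parity.GeneralizedHardyLittlewood.FordMaynardSieveConst01651SieveDecomposition` (fresh; the `Cruxes` copy keeps its own), files of
≤ 400 lines chained by import; the three registered stubs are replaced by their landed proofs
(`…StubSignClauseFive` p834287, `…StubCertValuePos` p837763, `…TypeIIRegion` p833045), so the skeleton's composition
`SieveConst01651_of_stubs` (last part) is sorry-free.  Mathematics, statements and comments are the linewriter's; this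
re-homing (hand `leafhand-parity-fordmaynardsieveco-2` g4) only moved the definitions (`Eset`, `sliceTest`, `mainG1`, `vk`,
the `Signature.*` statement abbreviations, `Phi`, `innerI`, `jumpSet`, `gval`, `symmExt`, `idxProd`, `gam`) into the first
file, added docstrings where missing, and renamed two unused binders.
Declarations in this part: `typeITerm_of_jumps`, `mem_jumpSet`, `jumpSet_subset_of_eq`, `jumpSet_pair_subset`, `card_jumpSet_le_one_of_monotone`, `jumpSet_not`, `card_jumpSet_le_one_of_antitone`, `card_jumpSet_le_of_antitone`, `card_jumpSet_le_two_of_ordConvex`, `Gwt_eq_gval`, `roughPart_dvd_of_le`, `pvec_mem_between`.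

References: [FordMaynard2024PrimeSieves] K. Ford, J. Maynard, *On the theory of prime producing sieves*, arXiv:2407.14368,
Theorem 7.3 (a), Proposition 7.19, §6.2, §7.2, §8.2.
-/

noncomputable section

open Finset
open Literature.NumberTheory.Sieve Literature.NumberTheory.Sieve.FordMaynard Literature.Barriers.Parity.FordMaynard
open Summit.Parity.GeneralizedHardyLittlewood.FordMaynardSieveConst01651SieveConst01651
  (hfun Admissible hfun_apply hfun_of_ne pvec roughPart smoothPart Gwt Hwt window IsRough Nset Rset mem_window mem_Nset mem_Rset
   coneCert openSmall stub_hkPieces stub_coneCertClosed_of_residues' coneCert_signClause_five_of_generic)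

namespace Summit.Parity.GeneralizedHardyLittlewood.FordMaynardSieveConst01651SieveDecomposition

/-- `typeITerm_of_jumps` — lemma of the line skeleton `sieve_decomposition` (v21, seat `linewriter-parity-smallroutes-1`), re-homed verbatim. [folklore] -/
theorem typeITerm_of_jumps (hJ : Signature.weightJumps) : Signature.typeITerm := by
  intro ν hν hν4 g hadm
  obtain ⟨C, hC0, hC⟩ := abs_Gwt_le_uniform hν hadm
  obtain ⟨C', hC'⟩ := hJ ν hν hν4 g hadm
  have hK0 : 0 ≤ C + 2 * C * max C' 0 :=
    add_nonneg hC0 (mul_nonneg (mul_nonneg zero_le_two hC0) (le_max_right _ _))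
  refine ⟨C + 2 * C * max C' 0, fun x hx B hB w hT => ?_⟩
  classical
  have hx0 : 0 ≤ x := by linarith
  have hN1 : 1 ≤ ⌊x⌋₊ := le_trans (by norm_num) (Nat.le_floor (by exact_mod_cast hx) : 2 ≤ ⌊x⌋₊)
  have hfub : ∑ n ∈ window x, w n * Hwt g ν n
      = ∑ d ∈ Icc 1 ⌊x⌋₊, ∑ n ∈ (window x).filter (fun n => d ∣ n), w n * Gwt g ν n d := by
    unfold Hwt
    simp_rw [mul_sum]
    refine sum_comm' ?_
    intro n d
    simp only [mem_filter, Nat.mem_divisors, mem_window, mem_Icc]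
    constructor
    · rintro ⟨⟨⟨h1, h2⟩, h3⟩, hd, hn0⟩
      exact ⟨⟨⟨⟨h1, h2⟩, h3⟩, hd⟩, Nat.pos_of_dvd_of_pos hd (by omega),
        le_trans (Nat.le_of_dvd (by omega) hd) h2⟩
    · rintro ⟨⟨⟨⟨h1, h2⟩, h3⟩, hd⟩, h4, h5⟩
      exact ⟨⟨⟨h1, h2⟩, h3⟩, hd, by omega⟩
  have hSsub : Icc 1 ⌊x ^ (1 / 2 : ℝ)⌋₊ ⊆ Icc 1 ⌊x⌋₊ := by
    intro d hd; rw [mem_Icc] at hd ⊢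
    refine ⟨hd.1, hd.2.trans (Nat.floor_le_floor ?_)⟩
    calc x ^ (1 / 2 : ℝ) ≤ x ^ (1 : ℝ) := Real.rpow_le_rpow_of_exponent_le (by linarith) (by norm_num)
      _ = x := Real.rpow_one x
  have hvan : ∀ d ∈ Icc 1 ⌊x⌋₊, d ∉ Icc 1 ⌊x ^ (1 / 2 : ℝ)⌋₊ →
      ∑ n ∈ (window x).filter (fun n => d ∣ n), w n * Gwt g ν n d = 0 := by
    intro d hd hdS
    refine sum_eq_zero fun n hn => ?_
    rw [mem_filter, mem_window] at hn
    rw [mem_Icc] at hd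
    have hdgt : x ^ (1 / 2 : ℝ) < d := by
      have : ⌊x ^ (1 / 2 : ℝ)⌋₊ < d := by
        by_contra h
        exact hdS (mem_Icc.2 ⟨hd.1, not_lt.1 h⟩)
      exact (Nat.floor_lt (by positivity)).1 this
    have hnx : (n : ℝ) ≤ x := (Nat.cast_le.2 hn.1.1.2).trans (Nat.floor_le hx0)
    have hcut : ¬ ((d : ℝ) ≤ (n : ℝ) ^ (1 / 2 : ℝ)) := by
      intro h
      have : (n : ℝ) ^ (1 / 2 : ℝ) ≤ x ^ (1 / 2 : ℝ) := Real.rpow_le_rpow (Nat.cast_nonneg _) hnx (by norm_num)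
      linarith
    unfold Gwt
    rw [if_neg hcut, mul_zero]
  rw [hfub, ← sum_subset hSsub hvan]
  set w' : ℕ → ℕ → ℝ := fun d k => if x / 2 < (d * k : ℝ) ∧ (d * k : ℝ) ≤ x then w (d * k) else 0 with hw'
  have hmaxd : ∀ d : ℕ, ∃ i ∈ Icc 1 ⌊x⌋₊, ∀ i' ∈ Icc 1 ⌊x⌋₊,
      |∑ k ∈ Icc 1 i', w' d k| ≤ |∑ k ∈ Icc 1 i, w' d k| := fun d =>
    exists_max_image (Icc 1 ⌊x⌋₊) (fun i => |∑ k ∈ Icc 1 i, w' d k|) ⟨1, by rw [mem_Icc]; omega⟩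
  choose istar histar hmax using hmaxd
  set I : ℕ → ℕ × ℕ := fun d => (1, istar d) with hI
  have hinner : ∀ d, innerI w x I d = ∑ k ∈ Icc 1 (istar d), w' d k := by
    intro d
    unfold innerI
    rw [sum_filter]
  have hper : ∀ d ∈ Icc 1 ⌊x ^ (1 / 2 : ℝ)⌋₊, |∑ n ∈ (window x).filter (fun n => d ∣ n), w n * Gwt g ν n d|
      ≤ (C + 2 * C * max C' 0) * (d.divisors.card : ℝ) * |innerI w x I d| := by
    intro d hd
    have hd1 : 1 ≤ d := (mem_Icc.1 hd).1
    have hd0 : d ≠ 0 := by omega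
    rw [sum_window_filter_dvd (fun n => w n * Gwt g ν n d) hx0 hd0]
    have hrw : ∑ k ∈ (Icc 1 ⌊x⌋₊).filter (fun k : ℕ => x / 2 < (d * k : ℝ) ∧ (d * k : ℝ) ≤ x),
          w (d * k) * Gwt g ν (d * k) d
        = ∑ k ∈ Icc 1 ⌊x⌋₊, w' d k * Gwt g ν (d * k) d := by
      rw [sum_filter]
      refine sum_congr rfl fun k _ => ?_
      simp only [hw']
      split_ifs <;> simp
    rw [hrw, hinner d]
    have hM0 : 0 ≤ |∑ k ∈ Icc 1 (istar d), w' d k| := abs_nonneg _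
    have hab := abel_bound (w' d) (fun k => Gwt g ν (d * k) d) ⌊x⌋₊ hM0 (hmax d)
    have hjump := sum_abs_diff_le (fun k => Gwt g ν (d * k) d) ⌊x⌋₊ (fun k => hC _ _)
    have hJd := hC' d hd1 ⌊x⌋₊
    have hτ : (1 : ℝ) ≤ d.divisors.card := by
      exact_mod_cast Finset.card_pos.2 ⟨d, Nat.mem_divisors_self d hd0⟩
    calc |∑ k ∈ Icc 1 ⌊x⌋₊, w' d k * Gwt g ν (d * k) d|
        ≤ (|Gwt g ν (d * ⌊x⌋₊) d| + ∑ k ∈ Ico 1 ⌊x⌋₊, |Gwt g ν (d * (k + 1)) d - Gwt g ν (d * k) d|)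
            * |∑ k ∈ Icc 1 (istar d), w' d k| := hab
      _ ≤ (C + 2 * C * (max C' 0 * (d.divisors.card : ℝ))) * |∑ k ∈ Icc 1 (istar d), w' d k| := by
          apply mul_le_mul_of_nonneg_right _ hM0
          apply add_le_add (hC _ _)
          refine hjump.trans ?_
          apply mul_le_mul_of_nonneg_left _ (by positivity)
          exact hJd.trans (mul_le_mul_of_nonneg_right (le_max_left _ _) (Nat.cast_nonneg _))
      _ ≤ (C + 2 * C * max C' 0) * (d.divisors.card : ℝ) * |∑ k ∈ Icc 1 (istar d), w' d k| := by
          apply mul_le_mul_of_nonneg_right _ hM0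
          nlinarith [hC0, le_max_right C' 0, hτ]
  have hTI : ∑ d ∈ Icc 1 ⌊x ^ (1 / 2 : ℝ)⌋₊, ((d.divisors.card : ℝ) ^ B) * |innerI w x I d|
      ≤ x / Real.log x ^ B := hT I
  calc |∑ d ∈ Icc 1 ⌊x ^ (1 / 2 : ℝ)⌋₊, ∑ n ∈ (window x).filter (fun n => d ∣ n), w n * Gwt g ν n d|
      ≤ ∑ d ∈ Icc 1 ⌊x ^ (1 / 2 : ℝ)⌋₊, |∑ n ∈ (window x).filter (fun n => d ∣ n), w n * Gwt g ν n d| :=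
        abs_sum_le_sum_abs _ _
    _ ≤ ∑ d ∈ Icc 1 ⌊x ^ (1 / 2 : ℝ)⌋₊, (C + 2 * C * max C' 0) * (d.divisors.card : ℝ) * |innerI w x I d| :=
        sum_le_sum hper
    _ ≤ ∑ d ∈ Icc 1 ⌊x ^ (1 / 2 : ℝ)⌋₊,
          (C + 2 * C * max C' 0) * (((d.divisors.card : ℝ) ^ B) * |innerI w x I d|) := by
        refine sum_le_sum fun d hd => ?_
        rw [mul_assoc]
        apply mul_le_mul_of_nonneg_left _ hK0
        apply mul_le_mul_of_nonneg_right _ (abs_nonneg _)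
        have hd0 : d ≠ 0 := by have := (mem_Icc.1 hd).1; omega
        have hτ : (1 : ℝ) ≤ d.divisors.card := by
          exact_mod_cast Finset.card_pos.2 ⟨d, Nat.mem_divisors_self d hd0⟩
        exact Real.self_le_rpow_of_one_le hτ hB
    _ = (C + 2 * C * max C' 0) *
          ∑ d ∈ Icc 1 ⌊x ^ (1 / 2 : ℝ)⌋₊, ((d.divisors.card : ℝ) ^ B) * |innerI w x I d| := by rw [mul_sum]
    _ ≤ (C + 2 * C * max C' 0) * (x / Real.log x ^ B) := mul_le_mul_of_nonneg_left hTI hK0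
    _ = (C + 2 * C * max C' 0) * x / Real.log x ^ B := by ring

/-- `mem_jumpSet` — lemma of the line skeleton `sieve_decomposition` (v21, seat `linewriter-parity-smallroutes-1`), re-homed verbatim. [folklore] -/
theorem mem_jumpSet {α : Type*} [DecidableEq α] {f : ℕ → α} {N k : ℕ} :
    k ∈ jumpSet f N ↔ (1 ≤ k ∧ k < N) ∧ f (k + 1) ≠ f k := by
  unfold jumpSet; rw [mem_filter, mem_Ico]

/-- `jumpSet_subset_of_eq` — lemma of the line skeleton `sieve_decomposition` (v21, seat `linewriter-parity-smallroutes-1`), re-homed verbatim. [folklore] -/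
theorem jumpSet_subset_of_eq {α β : Type*} [DecidableEq α] [DecidableEq β] {f : ℕ → α} {u : ℕ → β}
    (F : β → α) (hF : ∀ k, 1 ≤ k → f k = F (u k)) (N : ℕ) : jumpSet f N ⊆ jumpSet u N := by
  intro k hk
  rw [mem_jumpSet] at hk ⊢
  refine ⟨hk.1, fun h => hk.2 ?_⟩
  rw [hF k hk.1.1, hF (k + 1) (by omega), h]

/-- `jumpSet_pair_subset` — lemma of the line skeleton `sieve_decomposition` (v21, seat `linewriter-parity-smallroutes-1`), re-homed verbatim. [folklore] -/
theorem jumpSet_pair_subset {α β : Type*} [DecidableEq α] [DecidableEq β] (a : ℕ → α) (b : ℕ → β)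
    (N : ℕ) : jumpSet (fun k => (a k, b k)) N ⊆ jumpSet a N ∪ jumpSet b N := by
  intro k hk
  rw [mem_jumpSet] at hk
  rw [mem_union, mem_jumpSet, mem_jumpSet]
  by_cases ha : a (k + 1) = a k
  · right
    refine ⟨hk.1, fun hb => hk.2 ?_⟩
    rw [ha, hb]
  · left
    exact ⟨hk.1, ha⟩

/-- `card_jumpSet_le_one_of_monotone` — lemma of the line skeleton `sieve_decomposition` (v21, seat `linewriter-parity-smallroutes-1`), re-homed verbatim. [folklore] -/
theorem card_jumpSet_le_one_of_monotone {a : ℕ → Bool} (ha : ∀ k, 1 ≤ k → a k = true → a (k + 1) = true)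
    (N : ℕ) : (jumpSet a N).card ≤ 1 := by
  have hmono : ∀ k j, 1 ≤ k → k ≤ j → a k = true → a j = true := by
    intro k j hk hkj hak
    induction j, hkj using Nat.le_induction with
    | base => exact hak
    | succ j hkj ih => exact ha j (by omega) ih
  have hjump : ∀ k ∈ jumpSet a N, a k = false ∧ a (k + 1) = true := by
    intro k hk
    rw [mem_jumpSet] at hk
    by_cases h1 : a k = true
    · exact absurd ((ha k hk.1.1 h1).trans h1.symm) hk.2
    · have h1' : a k = false := by simpa using h1
      by_cases h2 : a (k + 1) = true
      · exact ⟨h1', h2⟩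
      · have h2' : a (k + 1) = false := by simpa using h2
        exact absurd (h2'.trans h1'.symm) hk.2
  refine Finset.card_le_one.2 fun k₁ hk₁ k₂ hk₂ => ?_
  by_contra hne
  rcases lt_or_gt_of_ne hne with h | h
  · have := hmono (k₁ + 1) k₂ (by omega) h (hjump k₁ hk₁).2
    rw [(hjump k₂ hk₂).1] at this
    exact Bool.false_ne_true this
  · have := hmono (k₂ + 1) k₁ (by omega) h (hjump k₂ hk₂).2
    rw [(hjump k₁ hk₁).1] at this
    exact Bool.false_ne_true this

/-- `jumpSet_not` — lemma of the line skeleton `sieve_decomposition` (v21, seat `linewriter-parity-smallroutes-1`), re-homed verbatim. [folklore] -/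
theorem jumpSet_not (a : ℕ → Bool) (N : ℕ) : jumpSet (fun k => !a k) N = jumpSet a N := by
  unfold jumpSet
  refine filter_congr fun k _ => ?_
  cases h1 : a (k + 1) <;> cases h2 : a k <;> simp [h1, h2]

/-- `card_jumpSet_le_one_of_antitone` — lemma of the line skeleton `sieve_decomposition` (v21, seat `linewriter-parity-smallroutes-1`), re-homed verbatim. [folklore] -/
theorem card_jumpSet_le_one_of_antitone {a : ℕ → Bool} (ha : ∀ k, 1 ≤ k → a (k + 1) = true → a k = true)
    (N : ℕ) : (jumpSet a N).card ≤ 1 := by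
  rw [← jumpSet_not]
  apply card_jumpSet_le_one_of_monotone
  intro k hk h
  by_cases h1 : a (k + 1) = true
  · have h2 := ha k hk h1
    simp [h2] at h
  · simpa using h1

/-- `card_jumpSet_le_of_antitone` — lemma of the line skeleton `sieve_decomposition` (v21, seat `linewriter-parity-smallroutes-1`), re-homed verbatim. [folklore] -/
theorem card_jumpSet_le_of_antitone {f : ℕ → ℕ} {D : Finset ℕ} (hf : ∀ k, 1 ≤ k → f (k + 1) ≤ f k)
    (hD : ∀ k, 1 ≤ k → f k ∈ D) (N : ℕ) : (jumpSet f N).card ≤ D.card := by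
  have hanti : ∀ k j, 1 ≤ k → k ≤ j → f j ≤ f k := by
    intro k j hk hkj
    induction j, hkj using Nat.le_induction with
    | base => exact le_rfl
    | succ j hkj ih => exact (hf j (by omega)).trans ih
  have H : ∀ {k₁ k₂}, k₁ ∈ jumpSet f N → k₂ ∈ jumpSet f N → f k₁ = f k₂ → ¬ k₁ < k₂ := by
    intro k₁ k₂ hk₁ hk₂ hfe hlt
    rw [mem_jumpSet] at hk₁ hk₂
    have h1 : f (k₁ + 1) < f k₁ := lt_of_le_of_ne (hf k₁ hk₁.1.1) hk₁.2
    have h2 : f k₂ ≤ f (k₁ + 1) := hanti (k₁ + 1) k₂ (by omega) hlt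
    omega
  have hmaps : Set.MapsTo f ↑(jumpSet f N) ↑D := by
    intro k hk
    exact Finset.mem_coe.2 (hD k (mem_jumpSet.1 (Finset.mem_coe.1 hk)).1.1)
  have hinj : Set.InjOn f ↑(jumpSet f N) := by
    intro k₁ hk₁ k₂ hk₂ hfe
    rcases lt_trichotomy k₁ k₂ with h | h | h
    · exact absurd h (H (Finset.mem_coe.1 hk₁) (Finset.mem_coe.1 hk₂) hfe)
    · exact h
    · exact absurd h (H (Finset.mem_coe.1 hk₂) (Finset.mem_coe.1 hk₁) hfe.symm)
  exact Finset.card_le_card_of_injOn f hmaps hinj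

/-- `card_jumpSet_le_two_of_ordConvex` — lemma of the line skeleton `sieve_decomposition` (v21, seat `linewriter-parity-smallroutes-1`), re-homed verbatim. [folklore] -/
theorem card_jumpSet_le_two_of_ordConvex {s : ℕ → Bool}
    (hS : ∀ k₁ k₂ k₃, 1 ≤ k₁ → k₁ ≤ k₂ → k₂ ≤ k₃ → s k₁ = true → s k₃ = true → s k₂ = true) (N : ℕ) :
    (jumpSet s N).card ≤ 2 := by
  classical
  set α : ℕ → Bool := fun k => decide (∃ j, 1 ≤ j ∧ j ≤ k ∧ s j = true) with hα
  set β : ℕ → Bool := fun k => decide (∃ j, k ≤ j ∧ s j = true) with hβ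
  have hF : ∀ k, 1 ≤ k → s k = ((α k, β k).1 && (α k, β k).2) := by
    intro k hk
    simp only [hα, hβ]
    by_cases h : s k = true
    · have h1 : ∃ j, 1 ≤ j ∧ j ≤ k ∧ s j = true := ⟨k, hk, le_rfl, h⟩
      have h2 : ∃ j, k ≤ j ∧ s j = true := ⟨k, le_rfl, h⟩
      rw [h, decide_eq_true h1, decide_eq_true h2]; rfl
    · have h' : s k = false := by simpa using h
      rw [h']
      by_cases h1 : ∃ j, 1 ≤ j ∧ j ≤ k ∧ s j = true
      · have h2 : ¬ ∃ j, k ≤ j ∧ s j = true := by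
          rintro ⟨j₂, hj₂, hS₂⟩
          obtain ⟨j₁, hj₁, hj₁k, hS₁⟩ := h1
          exact h (hS j₁ k j₂ hj₁ hj₁k hj₂ hS₁ hS₂)
        rw [decide_eq_true h1, decide_eq_false h2]; rfl
      · rw [decide_eq_false h1]; rfl
  have hsub := jumpSet_subset_of_eq (f := s) (u := fun k => (α k, β k))
    (fun p : Bool × Bool => p.1 && p.2) hF N
  have hα1 : (jumpSet α N).card ≤ 1 := by
    apply card_jumpSet_le_one_of_monotone
    intro k hk h
    simp only [hα, decide_eq_true_eq] at h ⊢
    obtain ⟨j, hj, hjk, hSj⟩ := h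
    exact ⟨j, hj, by omega, hSj⟩
  have hβ1 : (jumpSet β N).card ≤ 1 := by
    apply card_jumpSet_le_one_of_antitone
    intro k hk h
    simp only [hβ, decide_eq_true_eq] at h ⊢
    obtain ⟨j, hj, hSj⟩ := h
    exact ⟨j, by omega, hSj⟩
  calc (jumpSet s N).card ≤ (jumpSet (fun k => (α k, β k)) N).card := card_le_card hsub
    _ ≤ (jumpSet α N ∪ jumpSet β N).card := card_le_card (jumpSet_pair_subset α β N)
    _ ≤ (jumpSet α N).card + (jumpSet β N).card := card_union_le _ _
    _ ≤ 2 := by omega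

/-- `Gwt_eq_gval` — lemma of the line skeleton `sieve_decomposition` (v21, seat `linewriter-parity-smallroutes-1`), re-homed verbatim. [folklore] -/
theorem Gwt_eq_gval (g : VecFn) (ν : ℝ) (n m : ℕ) :
    Gwt g ν n m = if (m : ℝ) ≤ (n : ℝ) ^ (1 / 2 : ℝ) then
      ((ArithmeticFunction.moebius (m / roughPart ((n : ℝ) ^ ν) m) : ℤ) : ℝ) *
        gval g n (roughPart ((n : ℝ) ^ ν) m)
      else 0 := rfl

/-- `roughPart_dvd_of_le` — lemma of the line skeleton `sieve_decomposition` (v21, seat `linewriter-parity-smallroutes-1`), re-homed verbatim. [folklore] -/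
theorem roughPart_dvd_of_le {y y' : ℝ} (h : y ≤ y') (d : ℕ) : roughPart y' d ∣ roughPart y d := by
  unfold roughPart
  apply Finset.prod_dvd_prod_of_subset
  intro p hp
  rw [mem_filter] at hp ⊢
  exact ⟨hp.1, h.trans hp.2⟩

/-- `pvec_mem_between` — lemma of the line skeleton `sieve_decomposition` (v21, seat `linewriter-parity-smallroutes-1`), re-homed verbatim. [folklore] -/
theorem pvec_mem_between {e : ℕ} {Pj : Set (Fin e.primeFactorsList.length → ℝ)} (hP : IsConvexPolytope Pj)
    {n₁ n₂ n₃ : ℕ} (h1 : 1 < n₁) (h12 : n₁ ≤ n₂) (h23 : n₂ ≤ n₃)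
    (hm1 : pvec n₁ e ∈ Pj) (hm3 : pvec n₃ e ∈ Pj) : pvec n₂ e ∈ Pj := by
  obtain ⟨-, S, T, rfl⟩ := hP
  simp only [Set.mem_setOf_eq] at hm1 hm3 ⊢
  have hL1 : 0 < Real.log n₁ := Real.log_pos (by exact_mod_cast h1)
  have hL12 : Real.log n₁ ≤ Real.log n₂ := Real.log_le_log (by positivity) (by exact_mod_cast h12)
  have hL23 : Real.log n₂ ≤ Real.log n₃ :=
    Real.log_le_log (by exact_mod_cast (show 0 < n₂ by omega)) (by exact_mod_cast h23)
  have hL2 : 0 < Real.log n₂ := lt_of_lt_of_le hL1 hL12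
  have hL3 : 0 < Real.log n₃ := lt_of_lt_of_le hL2 hL23
  have key : ∀ (cv : Fin e.primeFactorsList.length → ℝ) (n : ℕ),
      ∑ i, cv i * pvec n e i = (∑ i, cv i * Real.log (e.primeFactorsList.get i)) / Real.log n := by
    intro cv n
    rw [Finset.sum_div]
    refine sum_congr rfl fun i _ => ?_
    simp only [pvec]
    ring
  have mono : ∀ (A : ℝ), A / Real.log n₂ ≤ A / Real.log n₁ ∨ A / Real.log n₂ ≤ A / Real.log n₃ := by
    intro A
    rcases le_or_gt 0 A with hA | hA
    · exact Or.inl (div_le_div_of_nonneg_left hA hL1 hL12)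
    · right
      rw [div_le_div_iff₀ hL2 hL3]
      nlinarith [mul_nonneg (neg_nonneg.2 hA.le) (sub_nonneg.2 hL23)]
  constructor
  · intro cv hc
    have a1 := hm1.1 cv hc
    have a3 := hm3.1 cv hc
    rw [key] at a1 a3 ⊢
    rcases mono (∑ i, cv.1 i * Real.log (e.primeFactorsList.get i)) with h | h
    · exact lt_of_le_of_lt h a1
    · exact lt_of_le_of_lt h a3
  · intro cv hc
    have a1 := hm1.2 cv hc
    have a3 := hm3.2 cv hc
    rw [key] at a1 a3 ⊢
    rcases mono (∑ i, cv.1 i * Real.log (e.primeFactorsList.get i)) with h | h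
    · exact h.trans a1
    · exact h.trans a3

end Summit.Parity.GeneralizedHardyLittlewood.FordMaynardSieveConst01651SieveDecomposition

end
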